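import Literature.NumberTheory.Transcendental.PhilipponZeroEstimateMultiplicity
import Literature.NumberTheory.Transcendental.GaGmBezout
import Mathlib.Algebra.Order.Antidiag.FinsuppEquiv
import HarnessLib

/-!
# Philippon's zero estimate on `𝔾ₐ × 𝔾ₘ^n`: Wüstholz's multiplicity lemma, Step 3 and the count

Topic `Literature/NumberTheory/Transcendental`. Sixth module of the inline discharge of
`Literature.NumberTheory.Transcendental.Philippon1986_GaGm`, continuing `…Multiplicity.lean`
(Roy, LNM 1752, Ch. 11, Prop. 3.8 Step 3; Philippon 1986, Prop. 4.7). With the data of that file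
(a prime `𝔭`, `g₁, …, g_s ∈ 𝔭` with `D_{wᵢ}g_j ∈ 𝔭 (i ≠ j)`, `D_{wᵢ}gᵢ ∉ 𝔭`, and an ideal `𝔮`
whose members are sent into `𝔭` by all `D^μ`, `|μ| ≤ T`) we PROVE:

* **`coeff_eq_zero_of_sum_mem`** (Step 3): if `(F_l)` are linearly independent modulo `𝔭`, a
  `ℂ`-combination of the products `F_l · g^κ` (`κ` in a finite set of multi-indices of order `≤ T`)
  lying in `𝔮` has all its coefficients zero (induction on `|κ|`, applying `D^μ` and Lemma B);
* **`choose_mul_hilbI_le`** (the count, for the box filtration of `GaGmZariski.lean` /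
  `GaGmBezout.lean`): if moreover `gᵢ ∈ Box(c)`, then for every `t`,
  `binom(T+s, s) · H_𝔭(t) ≤ H_𝔮(t + cT)` where `H_N(t) = dim Box(t) - dim(Box(t) ∩ N)`
  (`GaGm.hilbI`) — Roy's (95) `H(𝔮; D + dT) ≥ binom(T+s,s) H(𝔭; D)`.

## References

* Yu. V. Nesterenko, P. Philippon (eds.), *Introduction to Algebraic Independence Theory*,
  LNM 1752, Springer 2001, Ch. 11 (D. Roy), Prop. 3.8, Step 3, (95)–(97) (pp. 217–218).
* P. Philippon, *Lemmes de zéros dans les groupes algébriques commutatifs*, Bull. Soc. Math.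
  France 114 (1986), 355–383, Prop. 4.7.
-/

noncomputable section

open MvPolynomial Module

namespace Literature.NumberTheory.Transcendental

namespace GaGm

variable {n : ℕ}

section Step3

variable {s : ℕ} {w : Fin s → ℂ × (Fin n → ℂ)} {g : Fin s → MvPolynomial (Fin (n + 1)) ℂ}
  {𝔭 𝔮 : Ideal (MvPolynomial (Fin (n + 1)) ℂ)}

/-- **Step 3** (Roy, Prop. 3.8): let `K` be a finite set of multi-indices of order `≤ T` and
`(F_l)` a finite family linearly independent modulo the prime `𝔭`. If a `ℂ`-combination
`∑ c_{l,κ} F_l g^κ` lies in `𝔮` then all `c_{l,κ}`, `κ ∈ K`, vanish.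
[cite: NesterenkoPhilippon2001, Ch. 11 Prop. 3.8 (Step 3)] -/
theorem coeff_eq_zero_of_sum_mem (h𝔭 : 𝔭.IsPrime) (hg : ∀ i, g i ∈ 𝔭)
    (hoff : ∀ i j, i ≠ j → invDeriv (w i) (g j) ∈ 𝔭) (hdiag : ∀ i, invDeriv (w i) (g i) ∉ 𝔭)
    {T : ℕ} (H𝔮 : ∀ f ∈ 𝔮, ∀ μ : Fin s → ℕ, order μ ≤ T → opPow w μ f ∈ 𝔭)
    (K : Finset (Fin s → ℕ)) (hK : ∀ κ ∈ K, order κ ≤ T)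
    {ι : Type*} [Fintype ι] {F : ι → MvPolynomial (Fin (n + 1)) ℂ}
    (hF : ∀ c : ι → ℂ, (∑ l, c l • F l) ∈ 𝔭 → ∀ l, c l = 0)
    (c : ι → (Fin s → ℕ) → ℂ) (hc : (∑ l, ∑ κ ∈ K, c l κ • (F l * gpow g κ)) ∈ 𝔮) :
    ∀ l, ∀ κ ∈ K, c l κ = 0 := by
  classical
  -- bottom-up in the order
  suffices H : ∀ m, ∀ l, ∀ κ ∈ K, order κ < m → c l κ = 0 from
    fun l κ hκ => H (order κ + 1) l κ hκ (Nat.lt_succ_self _)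
  intro m
  induction m with
  | zero => intro l κ _ h; exact absurd h (Nat.not_lt_zero _)
  | succ m ih =>
    intro l₀ μ hμK hμm
    rcases Nat.lt_or_ge (order μ) m with hlt | hge
    · exact ih l₀ μ hμK hlt
    have hμ : order μ = m := by omega
    -- apply `D^μ` to the relation
    have h1 : opPow w μ (∑ l, ∑ κ ∈ K, c l κ • (F l * gpow g κ)) ∈ 𝔭 := H𝔮 _ hc μ (hμ ▸ hK μ hμK |> fun h => by omega)
    set r : ι → (Fin s → ℕ) → MvPolynomial (Fin (n + 1)) ℂ := fun l κ =>
      opPow w μ (F l * gpow g κ) - (if κ = μ then lemmaBUnit w g μ * F l else 0) with hr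
    have hexp : opPow w μ (∑ l, ∑ κ ∈ K, c l κ • (F l * gpow g κ)) =
        lemmaBUnit w g μ * (∑ l, c l μ • F l) + ∑ l, ∑ κ ∈ K, c l κ • r l κ := by
      rw [opPow_sum]
      simp_rw [opPow_sum, opPow_smul]
      have hterm : ∀ l κ, c l κ • opPow w μ (F l * gpow g κ) =
          c l κ • (if κ = μ then lemmaBUnit w g μ * F l else 0) + c l κ • r l κ := by
        intro l κ; rw [hr]; simp only; rw [← smul_add, add_sub_cancel]
      simp_rw [hterm, Finset.sum_add_distrib]
      congr 1
      rw [Finset.mul_sum]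
      refine Finset.sum_congr rfl fun l _ => ?_
      have hite : ∀ κ ∈ K, c l κ • (if κ = μ then lemmaBUnit w g μ * F l else 0) =
          if κ = μ then c l μ • (lemmaBUnit w g μ * F l) else 0 := fun κ _ => by
        split_ifs with h <;> simp [h]
      rw [Finset.sum_congr rfl hite, Finset.sum_ite_eq', if_pos hμK, mul_smul_comm]
    -- the `r`-part lies in `𝔭`
    have h2 : (∑ l, ∑ κ ∈ K, c l κ • r l κ) ∈ 𝔭 := by
      refine Ideal.sum_mem _ fun l _ => Ideal.sum_mem _ fun κ hκ => ?_
      rcases Nat.lt_or_ge (order κ) m with hlt | hge'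
      · rw [ih l κ hκ hlt, zero_smul]; exact Ideal.zero_mem _
      · rw [smul_eq_C_mul]
        exact Ideal.mul_mem_left _ _ (opPow_mul_gpow_sub_mem hg hoff m μ hμ (F l) κ hge')
    rw [hexp] at h1
    have h3 : lemmaBUnit w g μ * (∑ l, c l μ • F l) ∈ 𝔭 := by
      have := Ideal.sub_mem _ h1 h2
      rwa [add_sub_cancel_right] at this
    rcases h𝔭.mem_or_mem h3 with h4 | h4
    · exact absurd h4 (lemmaBUnit_notMem w h𝔭 hdiag μ)
    · exact hF (fun l => c l μ) h4 l₀

end Step3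

/-! ### The count for the box filtration -/

section Count

variable {D₀ D₁ : ℕ}

/-- Powers of box polynomials. [folklore] -/
theorem pow_mem_Box {c : ℕ} {P : MvPolynomial (Fin (n + 1)) ℂ} (hP : P ∈ Box (n := n) D₀ D₁ c) (k : ℕ) :
    P ^ k ∈ Box (n := n) D₀ D₁ (c * k) := by
  induction k with
  | zero => simpa using one_mem_Box (n := n) D₀ D₁ 0
  | succ k ih => rw [pow_succ, Nat.mul_succ]; exact mul_mem_Box ih hP

/-- Power products of box polynomials: `g^κ ∈ Box(c|κ|)`. [folklore] -/
theorem gpow_mem_Box {s c : ℕ} {g : Fin s → MvPolynomial (Fin (n + 1)) ℂ} (hg : ∀ i, g i ∈ Box (n := n) D₀ D₁ c)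
    (κ : Fin s → ℕ) : gpow g κ ∈ Box (n := n) D₀ D₁ (c * order κ) := by
  classical
  unfold gpow order
  have key : ∀ t : Finset (Fin s), ∏ i ∈ t, g i ^ κ i ∈ Box (n := n) D₀ D₁ (c * ∑ i ∈ t, κ i) := by
    intro t
    induction t using Finset.induction_on with
    | empty => simpa using one_mem_Box (n := n) D₀ D₁ 0
    | insert a t ha ih =>
      rw [Finset.prod_insert ha, Finset.sum_insert ha, Nat.mul_add]
      exact mul_mem_Box (pow_mem_Box (hg a) _) ih
  exact key Finset.univ

/-- The multi-indices of order `≤ T`, as the image of the antidiagonal of level `T` in `s + 1`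
variables under "drop the first coordinate" (so that its cardinality is `binom(T+s, s)`).
[folklore] -/
def indexSet (s T : ℕ) : Finset (Fin s → ℕ) :=
  ((Finset.univ : Finset (Fin (s + 1))).finsuppAntidiag T).image fun κ' i => κ' i.succ

/-- Members of `indexSet s T` have order `≤ T`. [folklore] -/
theorem order_le_of_mem_indexSet {s T : ℕ} {κ : Fin s → ℕ} (h : κ ∈ indexSet s T) : order κ ≤ T := by
  classical
  obtain ⟨κ', hκ', rfl⟩ := Finset.mem_image.mp h
  rw [Finset.mem_finsuppAntidiag] at hκ'
  obtain ⟨hsum, -⟩ := hκ'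
  have : (Finset.univ.sum fun i : Fin (s + 1) => κ' i) = T := hsum
  rw [Fin.sum_univ_succ] at this
  show ∑ i : Fin s, κ' i.succ ≤ T
  omega

/-- Stars and bars: `#indexSet s T = binom(T+s, s)`. [folklore] -/
theorem card_indexSet (s T : ℕ) : (indexSet s T).card = (T + s).choose s := by
  classical
  rw [indexSet, Finset.card_image_of_injOn, Finset.card_finsuppAntidiag_nat_eq_choose,
    Finset.card_univ, Fintype.card_fin, show s + 1 + T - 1 = T + s by omega, Nat.choose_symm_add]
  intro κ₁ h₁ κ₂ h₂ h
  rw [Finset.mem_coe, Finset.mem_finsuppAntidiag] at h₁ h₂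
  have hs : ∀ κ' : Fin (s + 1) →₀ ℕ, (Finset.univ.sum fun i : Fin (s + 1) => κ' i) = T →
      κ' 0 + ∑ i : Fin s, κ' i.succ = T := fun κ' hκ' => by
    rw [← hκ', Fin.sum_univ_succ]
  have e1 := hs κ₁ h₁.1
  have e2 := hs κ₂ h₂.1
  have htail : ∀ i : Fin s, κ₁ i.succ = κ₂ i.succ := fun i => congrFun h i
  ext i
  refine Fin.cases ?_ (fun i' => htail i') i
  have : ∑ i : Fin s, κ₁ i.succ = ∑ i : Fin s, κ₂ i.succ := Finset.sum_congr rfl fun i _ => htail i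
  omega

variable {s : ℕ} {w : Fin s → ℂ × (Fin n → ℂ)} {g : Fin s → MvPolynomial (Fin (n + 1)) ℂ}
  {𝔭 𝔮 : Ideal (MvPolynomial (Fin (n + 1)) ℂ)}

/-- **The count** (Roy (95)): `binom(T+s, s) · H_𝔭(t) ≤ H_𝔮(t + cT)` for the box filtration, with
`H_N(t) = dim Box(t) - dim(Box(t) ∩ N)` (`GaGm.hilbI`). [cite: NesterenkoPhilippon2001, Ch. 11 Prop. 3.8 (95)] -/
theorem choose_mul_hilbI_le (h𝔭 : 𝔭.IsPrime) (hg : ∀ i, g i ∈ 𝔭)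
    (hoff : ∀ i j, i ≠ j → invDeriv (w i) (g j) ∈ 𝔭) (hdiag : ∀ i, invDeriv (w i) (g i) ∉ 𝔭)
    {T : ℕ} (H𝔮 : ∀ f ∈ 𝔮, ∀ μ : Fin s → ℕ, order μ ≤ T → opPow w μ f ∈ 𝔭)
    {c : ℕ} (hgBox : ∀ i, g i ∈ Box (n := n) D₀ D₁ c) (t : ℕ) :
    (T + s).choose s * hilbI (n := n) D₀ D₁ (Submodule.restrictScalars ℂ 𝔭) t ≤
      hilbI (n := n) D₀ D₁ (Submodule.restrictScalars ℂ 𝔮) (t + c * T) := by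
  classical
  -- a basis of `Box(t)` modulo `Box(t) ∩ 𝔭`
  set V : Submodule ℂ (MvPolynomial (Fin (n + 1)) ℂ) := Box (n := n) D₀ D₁ t with hV
  set U : Submodule ℂ ↥V := (Submodule.restrictScalars ℂ 𝔭).comap V.subtype with hU
  set b := Module.finBasis ℂ (↥V ⧸ U) with hb
  set N := finrank ℂ (↥V ⧸ U) with hN
  have hNeq : N = hilbI (n := n) D₀ D₁ (Submodule.restrictScalars ℂ 𝔭) t := by
    have h1 := Submodule.finrank_quotient_add_finrank U
    have hmap : U.map V.subtype = V ⊓ Submodule.restrictScalars ℂ 𝔭 := by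
      ext x
      simp only [Submodule.mem_map, Submodule.mem_comap, Submodule.coe_subtype, hU,
        Submodule.mem_inf, Submodule.restrictScalars_mem]
      constructor
      · rintro ⟨y, hy, rfl⟩; exact ⟨y.2, hy⟩
      · rintro ⟨hx, hx'⟩; exact ⟨⟨x, hx⟩, hx', rfl⟩
    have h2 : finrank ℂ U = finrank ℂ ↥(V ⊓ Submodule.restrictScalars ℂ 𝔭) := by
      rw [← Submodule.finrank_map_subtype_eq V U, hmap]
    rw [hilbI, ← h1, h2, Nat.add_sub_cancel]
  -- lifts of the basis vectors
  choose F hF using fun l => Submodule.Quotient.mk_surjective U (b l)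
  have hFind : ∀ d : Fin N → ℂ, (∑ l, d l • (F l : MvPolynomial (Fin (n + 1)) ℂ)) ∈ 𝔭 →
      ∀ l, d l = 0 := by
    intro d hd
    have hmem : (∑ l, d l • F l : ↥V) ∈ U := by
      simp only [hU, Submodule.mem_comap, Submodule.coe_subtype, Submodule.restrictScalars_mem,
        Submodule.coe_sum, Submodule.coe_smul]
      exact hd
    have h0 : (∑ l, d l • b l : ↥V ⧸ U) = 0 := by
      have h := (Submodule.Quotient.mk_eq_zero U).mpr hmem
      rw [← Submodule.mkQ_apply, map_sum] at h
      simp_rw [map_smul, Submodule.mkQ_apply, hF] at h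
      exact h
    exact fun l => Fintype.linearIndependent_iff.mp b.linearIndependent d h0 l
  -- the family `Φ (l, κ) = F_l g^κ`, `κ ∈ K = indexSet s T`
  set K := indexSet s T with hK
  set Φ : Fin N × ↥K → MvPolynomial (Fin (n + 1)) ℂ := fun p => (F p.1 : MvPolynomial (Fin (n + 1)) ℂ) *
    gpow g p.2.1 with hΦ
  have hΦmem : ∀ p, Φ p ∈ Box (n := n) D₀ D₁ (t + c * T) := fun p =>
    Box_mono (by have := order_le_of_mem_indexSet p.2.2; nlinarith) (mul_mem_Box (F p.1).2
      (gpow_mem_Box hgBox p.2.1))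
  have hcoef : ∀ d : Fin N × ↥K → ℂ, (∑ p, d p • Φ p) ∈ 𝔮 → ∀ p, d p = 0 := by
    intro d hd p
    have key := coeff_eq_zero_of_sum_mem h𝔭 hg hoff hdiag H𝔮 K (fun κ hκ => order_le_of_mem_indexSet hκ)
      hFind (fun l κ => if h : κ ∈ K then d (l, ⟨κ, h⟩) else 0) ?_ p.1 p.2.1 p.2.2
    · simpa using key
    · have e : (∑ l, ∑ κ ∈ K, (if h : κ ∈ K then d (l, ⟨κ, h⟩) else 0) •
          ((F l : MvPolynomial (Fin (n + 1)) ℂ) * gpow g κ)) = ∑ p, d p • Φ p := by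
        rw [Fintype.sum_prod_type]
        refine Finset.sum_congr rfl fun l _ => ?_
        rw [← Finset.sum_coe_sort K]
        refine Finset.sum_congr rfl fun κ _ => ?_
        rw [dif_pos κ.2]
      rw [e]; exact hd
  have hli : LinearIndependent ℂ Φ :=
    Fintype.linearIndependent_iff.mpr fun d hd => hcoef d (by rw [hd]; exact Ideal.zero_mem _)
  set S := Submodule.span ℂ (Set.range Φ) with hS
  set Q := Box (n := n) D₀ D₁ (t + c * T) ⊓ Submodule.restrictScalars ℂ 𝔮 with hQ
  have hdisj : S ⊓ Q = ⊥ := by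
    rw [Submodule.eq_bot_iff]
    rintro x ⟨hx, hx'⟩
    obtain ⟨d, rfl⟩ := (Submodule.mem_span_range_iff_exists_fun ℂ).mp hx
    have h0 := hcoef d hx'.2
    simp [h0]
  have hle : S ⊔ Q ≤ Box (n := n) D₀ D₁ (t + c * T) :=
    sup_le (Submodule.span_le.mpr (by rintro _ ⟨p, rfl⟩; exact hΦmem p)) inf_le_left
  have hfinS : finrank ℂ S = N * K.card := by
    rw [hS, finrank_span_eq_card hli, Fintype.card_prod, Fintype.card_fin, Fintype.card_coe]
  haveI : FiniteDimensional ℂ S := FiniteDimensional.span_of_finite ℂ (Set.finite_range Φ)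
  haveI : FiniteDimensional ℂ Q := Submodule.finiteDimensional_of_le (inf_le_left :
    Q ≤ Box (n := n) D₀ D₁ (t + c * T))
  have hsum := Submodule.finrank_sup_add_finrank_inf_eq S Q
  rw [hdisj, finrank_bot, add_zero] at hsum
  have hmono := Submodule.finrank_mono hle
  rw [card_indexSet] at hfinS
  set P := (T + s).choose s * N with hP
  have hfinS' : finrank ℂ S = P := by rw [hfinS, hP, mul_comm]
  have hQle : finrank ℂ Q ≤ finrank ℂ ↥(Box (n := n) D₀ D₁ (t + c * T)) := Submodule.finrank_mono inf_le_left
  rw [← hNeq]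
  show P ≤ finrank ℂ ↥(Box (n := n) D₀ D₁ (t + c * T)) - finrank ℂ Q
  omega

end Count

end GaGm

end Literature.NumberTheory.Transcendental
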